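import Summits.AtomisticToContinuum.Crystallization.Theses.ThreeConeCertificate
import Literature.MathematicalPhysics.StatisticalMechanics.LennardJonesClusters
import Literature.MathematicalPhysics.StatisticalMechanics.CrystallizationSymmetries
import Literature.MathematicalPhysics.StatisticalMechanics.BarlowStacking
import Literature.MathematicalPhysics.StatisticalMechanics.HaggStacking

/-!
# `SlackRigidity` (stmt-AtomisticToContinuum-11960), negative side I (basics): non-vacuity, the energy
hypothesis is load-bearing, first necessary conditions on a witness, the `∀ P` version is false

Crux (route ThreeConeCertificate, verbatim `slackRigidity_iff`): `∃ P` periodic, `∀ R ε > 0`, along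
every injective sequence `x N : Fin N → ℝ³` with energy excess `(𝓔(x N) − E(N))/N → 0`, the fraction
of particles whose `R`-environment is not two-way `ε`-matched to `x i + A(P.points)` for some linear
isometry `A` tends to `0`.

Proved here (all sorry-free, axioms `propext`, `Classical.choice`, `Quot.sound`; the only inputs are
the tree theorems `LennardJonesGroundStatesExist_holds`, `LennardJonesMinimalDistance_holds`,
`isGroundState_comp_isometry_iff`, `card_le_of_separated_of_dist_le`, the hcp API of
`BarlowStacking.lean`, and Mathlib):

* non-vacuity: ground states meet the hypotheses with excess `≡ 0` (`excessVanishes_gs`);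
* `not_rigidForWithoutEnergy` — the energy hypothesis dropped ⇒ false for EVERY `P`;
* `not_rigidForWithoutRotations` — the isometry frozen to `A = 1` ⇒ false for EVERY `P`;
* necessary conditions on a witness: `zero_mem_points_of_rigidFor`, `norm_le_of_mem_points_of_rigidFor`,
  `rigidFor_unique_up_to_isometry`, `rigidFor_vertexTransitive`, `rigidFor_uniformlyDiscrete`;
* `not_forall_rigidFor` — the `∀ P` strengthening is false.

Use: ideators / planners / the lead may import this module; `rigidFor_vertexTransitive` is the
formal content of the route's remark "as typed P must be vertex-transitive (hcp, fcc are)": a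
dhcp/6H/9R-type Lennard-Jones optimum would make the crux false for every `P` while one-`P`
crystallisation could still hold.  Standing analysis file: `Cruxes/SlackRigidity/Disproof.lean`.
-/

noncomputable section

open scoped BigOperators Topology
open Filter Set Metric

namespace Summit.AtomisticToContinuum.Crystallization.Theorems.SlackRigidityNegative

open Literature.MathematicalPhysics.StatisticalMechanics
open Summit.AtomisticToContinuum.Crystallization.Theses.ThreeConeCertificate (SlackRigidity)


/-! ## § Setup -/

/-- Ambient space `ℝ³`. [folklore] -/
abbrev E3 := EuclideanSpace ℝ (Fin 3)

/-- Particle `i` of the configuration `x` is `(R, ε)`-matched to `P`: verbatim the predicate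
negated inside `SlackRigidity` (two-way `ε`-matching of `B_R(x i)` with `x i + A(P.points ∩ B_R)`
for some linear isometry `A`). [folklore] -/
def Good (P : PeriodicConfiguration 3) (R ε : ℝ) {N : ℕ} (x : Fin N → E3) (i : Fin N) : Prop :=
  ∃ A : E3 →ₗᵢ[ℝ] E3, (∀ p ∈ P.points, ‖p‖ ≤ R → ∃ j : Fin N, dist (x j) (x i + A p) ≤ ε) ∧
    (∀ j : Fin N, dist (x j) (x i) ≤ R → ∃ p ∈ P.points, dist (x j) (x i + A p) ≤ ε)

/-- Number of unmatched ("bad") particles. [folklore] -/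
def badCount (P : PeriodicConfiguration 3) (R ε : ℝ) {N : ℕ} (x : Fin N → E3) : ℕ :=
  Nat.card {i : Fin N // ¬ Good P R ε x i}

/-- The conclusion of the crux for `P` along the sequence `x`: bad fraction `→ 0`. [folklore] -/
def BadFractionVanishes (P : PeriodicConfiguration 3) (R ε : ℝ) (x : (N : ℕ) → Fin N → E3) : Prop :=
  Tendsto (fun N : ℕ => (badCount P R ε (x N) : ℝ) / N) atTop (𝓝 0)

/-- The energy hypothesis of the crux: excess `o(N)`. [folklore] -/
def ExcessVanishes (x : (N : ℕ) → Fin N → E3) : Prop :=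
  Tendsto (fun N : ℕ => (interactionEnergy lennardJones (x N) -
    groundStateEnergy lennardJones 3 N) / N) atTop (𝓝 0)

/-- The crux with its witness exposed: `SlackRigidity ↔ ∃ P, RigidFor P`. [folklore] -/
def RigidFor (P : PeriodicConfiguration 3) : Prop :=
  ∀ R ε : ℝ, 0 < R → 0 < ε → ∀ x : (N : ℕ) → Fin N → E3, (∀ N, Function.Injective (x N)) →
    ExcessVanishes x → BadFractionVanishes P R ε x

/-- Readback: the route declaration is literally `∃ P, RigidFor P`. [folklore] -/
theorem slackRigidity_iff : SlackRigidity ↔ ∃ P, RigidFor P := Iff.rfl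

/-- A sequence of Lennard-Jones ground states, one for each `N` (tree theorem
`LennardJonesGroundStatesExist_holds`, Blanc–Lewin 2015 §1.2). [folklore] -/
def gs (N : ℕ) : Fin N → E3 := Classical.choose (LennardJonesGroundStatesExist_holds N)

/-- Each `gs N` is a ground state. [folklore] -/
theorem gs_isGroundState (N : ℕ) : IsGroundState lennardJones (gs N) :=
  Classical.choose_spec (LennardJonesGroundStatesExist_holds N)

/-- Ground states consist of distinct points. [folklore] -/
theorem gs_injective (N : ℕ) : Function.Injective (gs N) := (gs_isGroundState N).1

/-- NON-VACUITY: ground states have excess `≡ 0`, so the hypotheses of the crux are met by `gs`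
(and by `φ ∘ gs` for any isometries `φ_N`). [folklore] -/
theorem excessVanishes_of_isGroundState {x : (N : ℕ) → Fin N → E3}
    (hx : ∀ N, IsGroundState lennardJones (x N)) : ExcessVanishes x := by
  have : (fun N : ℕ => (interactionEnergy lennardJones (x N) -
      groundStateEnergy lennardJones 3 N) / N) = fun _ => 0 := by
    funext N; rw [(hx N).2, sub_self, zero_div]
  simp only [ExcessVanishes, this]
  exact tendsto_const_nhds

/-- The ground-state sequence has vanishing (indeed zero) excess: the crux is NOT vacuous. [folklore] -/
theorem excessVanishes_gs : ExcessVanishes gs := excessVanishes_of_isGroundState gs_isGroundState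

/-- Uniform separation of the ground-state sequence (tree theorem
`LennardJonesMinimalDistance_holds`, `δ = 1/3`). [folklore] -/
theorem gs_separated : ∃ δ : ℝ, 0 < δ ∧ ∀ N (i j : Fin N), i ≠ j → δ ≤ dist (gs N i) (gs N j) := by
  obtain ⟨δ, hδ, h⟩ := LennardJonesMinimalDistance_holds
  exact ⟨δ, hδ, fun N i j hij => h N (gs N) (gs_isGroundState N) i j hij⟩

/-- If every particle is bad the bad count is `N`. [folklore] -/
theorem badCount_eq_of_forall_bad {P : PeriodicConfiguration 3} {R ε : ℝ} {N : ℕ} {x : Fin N → E3}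
    (h : ∀ i, ¬ Good P R ε x i) : badCount P R ε x = N := by
  unfold badCount
  rw [Nat.card_congr (Equiv.subtypeUnivEquiv h), Nat.card_eq_fintype_card, Fintype.card_fin]

/-- If along a sequence every particle is bad, the bad fraction is eventually `1`, not `→ 0`. [folklore] -/
theorem not_badFractionVanishes_of_forall_bad {P : PeriodicConfiguration 3} {R ε : ℝ}
    {x : (N : ℕ) → Fin N → E3} (h : ∀ N (i : Fin N), ¬ Good P R ε (x N) i) :
    ¬ BadFractionVanishes P R ε x := by
  intro hT
  have h1 : Tendsto (fun N : ℕ => (badCount P R ε (x N) : ℝ) / N) atTop (𝓝 1) := by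
    refine (tendsto_const_nhds (x := (1 : ℝ))).congr' ?_
    filter_upwards [eventually_ge_atTop 1] with N hN
    rw [badCount_eq_of_forall_bad (h N)]
    have : (N : ℝ) ≠ 0 := by exact_mod_cast Nat.one_le_iff_ne_zero.1 hN
    rw [div_self this]
  exact zero_ne_one (tendsto_nhds_unique hT h1)

/-- The distance from `x i` to the image point `x i + A p` is `‖p‖`. [folklore] -/
theorem dist_add_linearIsometry (A : E3 →ₗᵢ[ℝ] E3) (z p : E3) : dist (z + A p) z = ‖p‖ := by
  rw [dist_eq_norm, add_sub_cancel_left, A.norm_map]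

/-! ## § Load-bearing hypotheses -/

/-- The crux's inner statement for a witness `P` with the ENERGY-EXCESS HYPOTHESIS DROPPED (all
injective sequences). [folklore] -/
def RigidForWithoutEnergy (P : PeriodicConfiguration 3) : Prop :=
  ∀ R ε : ℝ, 0 < R → 0 < ε → ∀ x : (N : ℕ) → Fin N → E3,
    (∀ N, Function.Injective (x N)) → BadFractionVanishes P R ε x

/-- A periodic configuration containing `0` contains a non-zero point (its lattice has full rank). [folklore] -/
theorem exists_ne_zero_mem_points (P : PeriodicConfiguration 3) (h0 : (0 : E3) ∈ P.points) :
    ∃ p ∈ P.points, p ≠ 0 := by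
  -- the lattice is not `⊥` since it spans `ℝ³`
  have hspan : Submodule.span ℝ (P.lattice : Set E3) = ⊤ := IsZLattice.span_top
  by_contra hnone
  have hL : ∀ g ∈ P.lattice, g = 0 := by
    intro g hg
    have : (0 : E3) + g ∈ P.points := P.add_mem_points h0 hg
    rw [zero_add] at this
    by_contra hg0
    exact hnone ⟨g, this, hg0⟩
  have hbot : (P.lattice : Set E3) ⊆ {0} := fun g hg => hL g hg
  have : Submodule.span ℝ (P.lattice : Set E3) ≤ Submodule.span ℝ ({0} : Set E3) :=
    Submodule.span_mono hbot
  rw [hspan, Submodule.span_zero_singleton, top_le_iff] at this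
  -- `⊥ = ⊤` in `ℝ³` is absurd: the vector `single 0 1` is non-zero
  have hv : (EuclideanSpace.single (0 : Fin 3) (1 : ℝ) : E3) ∈ (⊥ : Submodule ℝ E3) := by
    rw [this]; exact Submodule.mem_top
  rw [Submodule.mem_bot] at hv
  have := congrArg (fun v : E3 => v 0) hv
  simp at this

/-- **`_false_without_` (energy).** Without the excess hypothesis the conclusion fails for EVERY
periodic `P`: if `0 ∉ P.points` every particle of every configuration is bad at small `ε`
(clause (b) with `j = i`); if `0 ∈ P.points`, take a non-zero `p ∈ P.points` and the collinear
configurations `i ↦ (4 i) • p`: all mutual distances are multiples of `4‖p‖`, so no particle sits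
at distance `∈ [¾‖p‖, 1¼‖p‖]` from another and clause (a) fails for `p`. (Such sequences have
excess `≥ (N−1)/12 · O(1)`, rightly excluded by `S`.) Any proof of the crux must use the energy. [folklore] -/
theorem not_rigidForWithoutEnergy (P : PeriodicConfiguration 3) : ¬ RigidForWithoutEnergy P := by
  intro hP
  by_cases h0 : (0 : E3) ∈ P.points
  · obtain ⟨p, hp, hp0⟩ := exists_ne_zero_mem_points P h0
    have hpn : 0 < ‖p‖ := norm_pos_iff.2 hp0
    set x : (N : ℕ) → Fin N → E3 := fun N i => (4 * ((i : ℕ) : ℝ)) • p with hx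
    have hinj : ∀ N, Function.Injective (x N) := by
      intro N i j hij
      have h1 : (4 * ((i : ℕ) : ℝ)) • p = (4 * ((j : ℕ) : ℝ)) • p := hij
      have h2 : (4 * ((i : ℕ) : ℝ)) = 4 * ((j : ℕ) : ℝ) := smul_left_injective ℝ hp0 h1
      have h3 : ((i : ℕ) : ℝ) = ((j : ℕ) : ℝ) := by linarith
      exact Fin.ext (by exact_mod_cast h3)
    have hdist : ∀ N (i j : Fin N), dist (x N j) (x N i) = |((j : ℕ) : ℝ) - ((i : ℕ) : ℝ)| * (4 * ‖p‖) := by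
      intro N i j
      simp only [hx, dist_eq_norm, ← sub_smul, norm_smul, Real.norm_eq_abs]
      rw [show (4 : ℝ) * ((j : ℕ) : ℝ) - 4 * ((i : ℕ) : ℝ) = 4 * (((j : ℕ) : ℝ) - ((i : ℕ) : ℝ)) by ring,
        abs_mul, abs_of_pos (by norm_num : (0 : ℝ) < 4)]
      ring
    have hbad : ∀ N (i : Fin N), ¬ Good P ‖p‖ (‖p‖ / 4) (x N) i := by
      rintro N i ⟨A, h1, -⟩
      obtain ⟨j, hj⟩ := h1 p hp le_rfl
      have htri : |dist (x N j) (x N i) - ‖p‖| ≤ ‖p‖ / 4 := by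
        have h := abs_dist_sub_le (x N j) (x N i + A p) (x N i)
        rw [dist_add_linearIsometry] at h
        -- |d(j,i) - ‖p‖| ≤ d(j, i + Ap)
        have h' : |dist (x N j) (x N i) - ‖p‖| ≤ dist (x N j) (x N i + A p) := by
          have := abs_sub_comm (dist (x N j) (x N i)) ‖p‖
          calc |dist (x N j) (x N i) - ‖p‖|
              = |dist (x N j) (x N i) - dist (x N i + A p) (x N i)| := by rw [dist_add_linearIsometry]
            _ ≤ dist (x N j) (x N i + A p) := abs_dist_sub_le _ _ _
        exact h'.trans hj
      rw [hdist] at htri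
      set k : ℝ := |((j : ℕ) : ℝ) - ((i : ℕ) : ℝ)| with hk
      -- `k` is a natural number (as a real): either `0` or `≥ 1`
      have hk_cases : k = 0 ∨ 1 ≤ k := by
        have : ∃ n : ℕ, k = n := by
          rcases le_total ((i : ℕ)) ((j : ℕ)) with hle | hle
          · refine ⟨(j : ℕ) - (i : ℕ), ?_⟩
            rw [hk, Nat.cast_sub hle, abs_of_nonneg (by rw [sub_nonneg]; exact_mod_cast hle)]
          · refine ⟨(i : ℕ) - (j : ℕ), ?_⟩
            rw [hk, Nat.cast_sub hle, abs_sub_comm,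
              abs_of_nonneg (by rw [sub_nonneg]; exact_mod_cast hle)]
        obtain ⟨n, hn⟩ := this
        rcases Nat.eq_zero_or_pos n with h | h
        · left; rw [hn, h, Nat.cast_zero]
        · right; rw [hn]; exact_mod_cast h
      rcases hk_cases with hk0 | hk1
      · rw [hk0, zero_mul, zero_sub, abs_neg, abs_of_pos hpn] at htri
        linarith
      · have : 4 * ‖p‖ ≤ k * (4 * ‖p‖) := le_mul_of_one_le_left (by positivity) hk1
        have h5 : k * (4 * ‖p‖) - ‖p‖ ≤ ‖p‖ / 4 := (le_abs_self _).trans htri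
        linarith
    exact not_badFractionVanishes_of_forall_bad hbad
      (hP ‖p‖ (‖p‖ / 4) hpn (by positivity) x hinj)
  · -- `0 ∉ P.points`: a small ball about `0` misses `P.points`; clause (b) with `j = i` fails
    have hfin : (closedBall (0 : E3) 1 ∩ P.points).Finite := P.finite_inter_points isBounded_closedBall
    have hopen : IsOpen (closedBall (0 : E3) 1 ∩ P.points)ᶜ := hfin.isClosed.isOpen_compl
    have hmem : (0 : E3) ∈ (closedBall (0 : E3) 1 ∩ P.points)ᶜ := fun h => h0 h.2
    obtain ⟨ε₀, hε₀, hball⟩ := Metric.mem_nhds_iff.1 (hopen.mem_nhds hmem)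
    obtain ⟨ε, hε, hε1, hε2⟩ : ∃ ε : ℝ, 0 < ε ∧ ε ≤ ε₀ / 2 ∧ ε ≤ 1 / 2 :=
      ⟨min (ε₀ / 2) (1 / 2), lt_min (by linarith) (by norm_num), min_le_left _ _, min_le_right _ _⟩
    have hfar : ∀ q ∈ P.points, ε < ‖q‖ := by
      intro q hq
      by_contra hle
      rw [not_lt] at hle
      have hq1 : q ∈ closedBall (0 : E3) 1 := by
        rw [mem_closedBall, dist_zero_right]; linarith
      have hq2 : q ∈ ball (0 : E3) ε₀ := by
        rw [mem_ball, dist_zero_right]; linarith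
      exact hball hq2 ⟨hq1, hq⟩
    have hbad : ∀ N (i : Fin N), ¬ Good P 1 ε (gs N) i := by
      rintro N i ⟨A, -, h2⟩
      obtain ⟨q, hq, hqi⟩ := h2 i (by simp)
      rw [dist_comm, dist_add_linearIsometry] at hqi
      have := hfar q hq
      linarith
    exact not_badFractionVanishes_of_forall_bad hbad (hP 1 ε one_pos hε gs gs_injective)

/-- Hence no periodic configuration at all satisfies the energy-free version. [folklore] -/
theorem not_exists_rigidForWithoutEnergy :
    ¬ ∃ P : PeriodicConfiguration 3, RigidForWithoutEnergy P :=
  fun ⟨P, hP⟩ => not_rigidForWithoutEnergy P hP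

/-! ## § Necessary conditions on a witness -/

/-- **A witness contains the origin** (clause (b) with `j = i` at every `ε`; uses only that the
hypotheses are satisfiable, `excessVanishes_gs`). Hence "P = hcp" must be read with a particle AT
`0` (the route's informal text says so; the typed statement enforces it). [folklore] -/
theorem zero_mem_points_of_rigidFor {P : PeriodicConfiguration 3} (hP : RigidFor P) :
    (0 : E3) ∈ P.points := by
  by_contra h0
  have hfin : (closedBall (0 : E3) 1 ∩ P.points).Finite := P.finite_inter_points isBounded_closedBall
  have hopen : IsOpen (closedBall (0 : E3) 1 ∩ P.points)ᶜ := hfin.isClosed.isOpen_compl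
  have hmem : (0 : E3) ∈ (closedBall (0 : E3) 1 ∩ P.points)ᶜ := fun h => h0 h.2
  obtain ⟨ε₀, hε₀, hball⟩ := Metric.mem_nhds_iff.1 (hopen.mem_nhds hmem)
  obtain ⟨ε, hε, hε1, hε2⟩ : ∃ ε : ℝ, 0 < ε ∧ ε ≤ ε₀ / 2 ∧ ε ≤ 1 / 2 :=
    ⟨min (ε₀ / 2) (1 / 2), lt_min (by linarith) (by norm_num), min_le_left _ _, min_le_right _ _⟩
  have hfar : ∀ q ∈ P.points, ε < ‖q‖ := by
    intro q hq
    by_contra hle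
    rw [not_lt] at hle
    have hq1 : q ∈ closedBall (0 : E3) 1 := by
      rw [mem_closedBall, dist_zero_right]; linarith
    have hq2 : q ∈ ball (0 : E3) ε₀ := by
      rw [mem_ball, dist_zero_right]; linarith
    exact hball hq2 ⟨hq1, hq⟩
  have hbad : ∀ N (i : Fin N), ¬ Good P 1 ε (gs N) i := by
    rintro N i ⟨A, -, h2⟩
    obtain ⟨q, hq, hqi⟩ := h2 i (by simp)
    rw [dist_comm, dist_add_linearIsometry] at hqi
    have := hfar q hq
    linarith
  exact not_badFractionVanishes_of_forall_bad hbad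
    (hP 1 ε one_pos hε gs gs_injective excessVanishes_gs)

/-- **A witness has no point in the punctured `δ`-ball about `0`**, `δ > 0` the uniform separation
of Lennard-Jones ground states (tree: `δ = 1/3`): a point `p` with `0 < ‖p‖ < δ` would have to be
matched, around every good particle of a ground state, by a second particle at distance `< δ`.
So the typed matching pins the local scale of `P`: no over-dense junk witness. [folklore] -/
theorem norm_le_of_mem_points_of_rigidFor :
    ∃ δ : ℝ, 0 < δ ∧ ∀ P : PeriodicConfiguration 3, RigidFor P → ∀ p ∈ P.points, p ≠ 0 → δ ≤ ‖p‖ := by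
  obtain ⟨δ, hδ, hsep⟩ := gs_separated
  refine ⟨δ, hδ, fun P hP p hp hp0 => ?_⟩
  by_contra hlt
  rw [not_le] at hlt
  have hpn : 0 < ‖p‖ := norm_pos_iff.2 hp0
  obtain ⟨ε, hε, hε1, hε2⟩ : ∃ ε : ℝ, 0 < ε ∧ ε ≤ ‖p‖ / 2 ∧ ε ≤ (δ - ‖p‖) / 2 :=
    ⟨min (‖p‖ / 2) ((δ - ‖p‖) / 2), lt_min (by linarith) (by linarith), min_le_left _ _,
      min_le_right _ _⟩
  have hbad : ∀ N (i : Fin N), ¬ Good P ‖p‖ ε (gs N) i := by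
    rintro N i ⟨A, h1, -⟩
    obtain ⟨j, hj⟩ := h1 p hp le_rfl
    by_cases hji : j = i
    · subst hji
      rw [dist_comm, dist_add_linearIsometry] at hj
      linarith
    · have h3 : δ ≤ dist (gs N j) (gs N i) := hsep N j i hji
      have h4 : dist (gs N j) (gs N i) ≤ dist (gs N j) (gs N i + A p) + ‖p‖ :=
        calc dist (gs N j) (gs N i)
            ≤ dist (gs N j) (gs N i + A p) + dist (gs N i + A p) (gs N i) := dist_triangle _ _ _
          _ = dist (gs N j) (gs N i + A p) + ‖p‖ := by rw [dist_add_linearIsometry]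
      linarith
  exact not_badFractionVanishes_of_forall_bad hbad
    (hP ‖p‖ ε hpn hε gs gs_injective excessVanishes_gs)

/-! ## § Refuted strengthenings -/

/-- **The `∀ P` strengthening is false**: the over-dense hcp with spacings `a = h = δ/2` has the
point `barlowPos 1 0 0` at norm `√(a²/3 + h²) = δ/√3 < δ` (`norm_le_of_mem_points_of_rigidFor`).
(Trivial, but it certifies in Lean that the conclusion is a genuine condition on `P`.) [folklore] -/
theorem not_forall_rigidFor : ¬ ∀ P : PeriodicConfiguration 3, RigidFor P := by
  intro h
  obtain ⟨δ, hδ, hall⟩ := norm_le_of_mem_points_of_rigidFor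
  have ha : (δ / 2 : ℝ) ≠ 0 := by positivity
  have hp : barlowPos (δ / 2) (δ / 2) alternatingHagg 1 0 0 ∈
      (hcpPeriodicConfiguration ha ha).points := by
    rw [hcpPeriodicConfiguration_points]
    exact barlowPos_mem 1 0 0
  have h0 : barlowPos (δ / 2) (δ / 2) alternatingHagg 0 0 0 = 0 := by
    simp [barlowPos]
  have hd := dist_barlowPos_succ_eq (δ / 2) (δ / 2) isHaggSeq_alternating 0 0 0
  rw [zero_add, h0, dist_zero_right] at hd
  have hlt : ‖barlowPos (δ / 2) (δ / 2) alternatingHagg 1 0 0‖ < δ := by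
    rw [hd, Real.sqrt_lt' hδ]
    nlinarith
  have hpos : 0 < ‖barlowPos (δ / 2) (δ / 2) alternatingHagg 1 0 0‖ := by
    rw [hd]; positivity
  have hne : barlowPos (δ / 2) (δ / 2) alternatingHagg 1 0 0 ≠ 0 := norm_pos_iff.1 hpos
  have := hall _ (h _) _ hp hne
  linarith

end Summit.AtomisticToContinuum.Crystallization.Theorems.SlackRigidityNegative

end
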